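import Summits.Ventures.PercRepro.Night2NearFatNineCount
import Summits.Ventures.PercRepro.Night2NearFatSixTen

/-!
# night-2: THE NINE-POINT LINE AT `|G| = 16` — the tools (gen 40)

A basis line `cl {a, b}` with seven points of `W` at `|W| = 10` (a nine-point line of `V`): the faces at `a` and `b` meet `W`
off the line (`inter_face_inter_line_eq_empty`: `rk (cl (Q.erase a) ∩ cl {a, b}) ≤ 5 + 2 − 6 = 1`), so they hold `≤ 3` points
(`card_inter_face_le_of_line`); no six-point three-planar line exists next to a line of `≥ 5` points
(`clF_eq_of_six_line_of_five`, `no_six_line_of_long_line`), so every load above level five is a distance-1 load; the cell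
`ntpIncomeB 10 6 7 0 7 0 3 = 27503/25740` (`ntpIncomeB_anti_e`, `ntpIncomeB_comm`).  Paper: proofs/NIGHT-2-g40.md §10.
-/

namespace PercRepro.Shadow

open PercRepro.ThmH PercRepro.PerFlat

variable {α : Type*} [DecidableEq α] {M : Matroid α} [M.Finite] {G : Finset α}

/-- **A face at a basis point of a basis line meets `W` off that line**: `W ∩ cl (Q.erase a) ∩ cl {a, b} = ∅`. -/
theorem inter_face_inter_line_eq_empty (hG : G ∈ flatsQ M (5 + 1)) (hd : (gr M \ G).card = 2)
    (hk : kColoops M G = 1) (hs : ∀ e ∈ gr M, ∀ f ∈ gr M, e ≠ f → rkN M {e, f} = 2)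
    {B : Finset α} (hB : B ∈ thinMembers M 5 G) (hnP : ¬ bigP M G B) {z : α} (hz : z ∈ G \ clF M B)
    {a b : α} (ha : a ∈ insert z B \ coloops M G) (hb : b ∈ insert z B \ coloops M G) (hab : a ≠ b) :
    ((G \ insert z B) ∩ clF M ((insert z B).erase a)) ∩ clF M {a, b} = ∅ := by
  have hGg : G ⊆ gr M := (mem_flatsQ.1 hG).1
  have hQG : insert z B ⊆ G := Finset.insert_subset (Finset.mem_sdiff.1 hz).1 (subset_G_of_mem_thinMembers hB)
  have hQg : insert z B ⊆ gr M := hQG.trans hGg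
  have haQ : a ∈ insert z B := (Finset.mem_sdiff.1 ha).1
  have hbQ : b ∈ insert z B := (Finset.mem_sdiff.1 hb).1
  have hpair : ({a, b} : Finset α) ⊆ gr M := by
    intro e he
    rw [Finset.mem_insert, Finset.mem_singleton] at he
    rcases he with rfl | rfl
    · exact hQg haQ
    · exact hQg hbQ
  have h6 : rkN M (insert z B) = 6 := rkN_insert_eq_six_of_thin hG hB hz
  -- `a` is a coloop of `Q`: `a ∉ cl (Q.erase a)`
  have hind : M.Indep ((insert z B : Finset α) : Set α) := indep_insert_of_basis_pair hG hd hk hB hnP hz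
  have hrkF : rkN M ((insert z B).erase a) = 5 := by
    rw [rkN_eq_card_of_indep (hind.subset (by exact_mod_cast (Finset.erase_subset a (insert z B))))]
    rw [Finset.card_erase_of_mem haQ]
    have : rkN M (insert z B) = (insert z B).card := rkN_eq_card_of_indep hind
    omega
  have hU : insert z B ⊆ clF M ((insert z B).erase a) ∪ clF M {a, b} := by
    intro v hv
    rw [Finset.mem_union]
    by_cases hva : v = a
    · exact Or.inr (subset_clF_of_subset_gr hpair (hva ▸ Finset.mem_insert_self _ _))
    · exact Or.inl (subset_clF_of_subset_gr ((Finset.erase_subset _ _).trans hQg) (Finset.mem_erase.2 ⟨hva, hv⟩))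
  have hrkU := rkN_mono (M := M) hU
  rw [h6] at hrkU
  have hsm := rkN_submod (M := M) (clF M ((insert z B).erase a)) (clF M {a, b})
  rw [rkN_clF, rkN_clF, hrkF, hs a (hQg haQ) b (hQg hbQ) hab] at hsm
  have hIg : clF M ((insert z B).erase a) ∩ clF M {a, b} ⊆ gr M := fun v hv => mem_gr_of_mem_clF (Finset.mem_inter.1 hv).1
  have hbI : b ∈ clF M ((insert z B).erase a) ∩ clF M {a, b} :=
    Finset.mem_inter.2 ⟨subset_clF_of_subset_gr ((Finset.erase_subset _ _).trans hQg) (Finset.mem_erase.2 ⟨Ne.symm hab, hbQ⟩),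
      subset_clF_of_subset_gr hpair (Finset.mem_insert_of_mem (Finset.mem_singleton_self _))⟩
  rw [Finset.eq_empty_iff_forall_notMem]
  intro w hw
  rw [Finset.mem_inter, Finset.mem_inter] at hw
  have hwb : w ≠ b := fun h => (Finset.mem_sdiff.1 hw.1.1).2 (h ▸ hbQ)
  have h2 := rkN_pair_eq_two hs hIg (Finset.mem_inter.2 ⟨hw.1.2, hw.2⟩) hbI hwb
  omega


/-- The face at a basis point of a basis line holds at most `|W| − |W ∩ cl {a, b}|` points of `W`. -/
theorem card_inter_face_le_of_line (hG : G ∈ flatsQ M (5 + 1)) (hd : (gr M \ G).card = 2)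
    (hk : kColoops M G = 1) (hs : ∀ e ∈ gr M, ∀ f ∈ gr M, e ≠ f → rkN M {e, f} = 2)
    {B : Finset α} (hB : B ∈ thinMembers M 5 G) (hnP : ¬ bigP M G B) {z : α} (hz : z ∈ G \ clF M B)
    {a b : α} (ha : a ∈ insert z B \ coloops M G) (hb : b ∈ insert z B \ coloops M G) (hab : a ≠ b) :
    ((G \ insert z B) ∩ clF M ((insert z B).erase a)).card + ((G \ insert z B) ∩ clF M {a, b}).card ≤
      (G \ insert z B).card := by
  have hempty := inter_face_inter_line_eq_empty hG hd hk hs hB hnP hz ha hb hab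
  have hsub : (G \ insert z B) ∩ clF M ((insert z B).erase a) ⊆ (G \ insert z B) \ ((G \ insert z B) ∩ clF M {a, b}) := by
    intro w hw
    rw [Finset.mem_sdiff, Finset.mem_inter]
    refine ⟨(Finset.mem_inter.1 hw).1, fun h => ?_⟩
    have : w ∈ ((G \ insert z B) ∩ clF M ((insert z B).erase a)) ∩ clF M {a, b} := Finset.mem_inter.2 ⟨hw, h.2⟩
    rw [hempty] at this
    exact Finset.notMem_empty w this
  have h := Finset.card_le_card hsub
  rw [Finset.card_sdiff_of_subset Finset.inter_subset_left] at h
  have := Finset.card_le_card (Finset.inter_subset_left (s₁ := G \ insert z B) (s₂ := clF M {a, b}))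
  omega

/-- **At `|V| = 15` the six-point line of a lossy big set with no good point is the only line with `≥ 5` points**: any
rank-2 set `R₂ ⊆ V` whose line carries `≥ 5` points of `V` spans the same line. -/
theorem clF_eq_of_six_line_of_five (hG : G ∈ flatsQ M (5 + 1)) (hd : (gr M \ G).card = 2)
    (hk : kColoops M G = 1) (hs : ∀ e ∈ gr M, ∀ f ∈ gr M, e ≠ f → rkN M {e, f} = 2)
    (hl : ∀ e ∈ gr M, M.Indep {e}) (hnf : fatClosures M 5 G 2 = ∅) (h15 : (G \ coloops M G).card = 15)
    {B₁ : Finset α} (hB₁ : B₁ ∈ thinMembers M 5 G) (hbig₁ : 5 ≤ (B₁ \ coloops M G).card) {z₁ : α}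
    (hz₁ : z₁ ∈ G \ clF M B₁) (hloss₁ : loss M 5 G B₁ z₁ ≠ 0) {R₁ : Finset α}
    (hRQ₁ : R₁ ⊆ insert z₁ B₁ \ coloops M G) (hR2₁ : rkN M R₁ = 2)
    (hRcard₁ : R₁.card + 3 = (insert z₁ B₁ \ coloops M G).card) (hempty₁ : gtPts M 5 G (insert z₁ B₁) = ∅)
    (h6₁ : ((G \ coloops M G) ∩ clF M R₁).card = 6)
    {R₂ : Finset α} (hR2₂ : rkN M R₂ = 2) (hR₂V : R₂ ⊆ G \ coloops M G)
    (h6₂ : 5 ≤ ((G \ coloops M G) ∩ clF M R₂).card) :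
    clF M R₁ = clF M R₂ := by
  obtain ⟨c, hc, d, hd', e, he, hcd, hce, hde, hcov, hS, hdisj⟩ :=
    missed_sets_of_gtPts_eq_empty hG hd hk hs hl hnf hB₁ hbig₁ hz₁ hloss₁ hRQ₁ hR2₁ hRcard₁ hempty₁
  have hGg : G ⊆ gr M := (mem_flatsQ.1 hG).1
  have hVg : G \ coloops M G ⊆ gr M := Finset.sdiff_subset.trans hGg
  have hQG : insert z₁ B₁ ⊆ G :=
    Finset.insert_subset (Finset.mem_sdiff.1 hz₁).1 (subset_G_of_mem_thinMembers hB₁)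
  have hR₁g : R₁ ⊆ gr M := hRQ₁.trans (Finset.sdiff_subset.trans (hQG.trans hGg))
  have hR₂g : R₂ ⊆ gr M := hR₂V.trans hVg
  set V := G \ coloops M G with hV
  set L₁ := V ∩ clF M R₁ with hL₁
  set L₂ := V ∩ clF M R₂ with hL₂
  -- each missed set has exactly three points: `|V| ≥ |L₁| + |S_c| + |S_d| + |S_e|`
  have hS3 : ∀ u ∈ coloops M (insert z₁ B₁ \ coloops M G), (G \ clF M ((insert z₁ B₁).erase u)).card ≤ 3 := by
    intro u hu
    -- the other two coloops
    have h3 := card_coloops_eq_three_of_loss_ne_zero hG hd hk hs hl hB₁ hbig₁ hz₁ hloss₁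
    have hC : coloops M (insert z₁ B₁ \ coloops M G) = {c, d, e} := by
      symm
      apply Finset.eq_of_subset_of_card_le
      · intro x hx
        simp only [Finset.mem_insert, Finset.mem_singleton] at hx
        rcases hx with rfl | rfl | rfl <;> assumption
      · rw [h3, Finset.card_eq_three.2 ⟨c, d, e, hcd, hce, hde, rfl⟩]
    have hothers : ∃ v ∈ coloops M (insert z₁ B₁ \ coloops M G), ∃ w ∈ coloops M (insert z₁ B₁ \ coloops M G),
        u ≠ v ∧ u ≠ w ∧ v ≠ w := by
      have hu' : u = c ∨ u = d ∨ u = e := by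
        rw [hC] at hu
        simpa using hu
      rcases hu' with rfl | rfl | rfl
      · exact ⟨d, hd', e, he, hcd, hce, hde⟩
      · exact ⟨c, hc, e, he, Ne.symm hcd, hde, hce⟩
      · exact ⟨c, hc, d, hd', Ne.symm hce, Ne.symm hde, hcd⟩
    obtain ⟨v, hv, w, hw, huv, huw, hvw⟩ := hothers
    set Su := G \ clF M ((insert z₁ B₁).erase u) with hSu
    set Sv := G \ clF M ((insert z₁ B₁).erase v) with hSv
    set Sw := G \ clF M ((insert z₁ B₁).erase w) with hSw
    have h1 : (L₁ ∪ Su).card = L₁.card + Su.card := by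
      have := Finset.card_union_add_card_inter L₁ Su
      have h0 : (L₁ ∩ Su).card = 0 := by
        rw [Finset.card_eq_zero, Finset.eq_empty_iff_forall_notMem]
        intro x hx
        rw [Finset.mem_inter] at hx
        exact (hS u hu).2.2 x hx.2 (Finset.mem_inter.1 hx.1).2
      omega
    have h2 : (L₁ ∪ Su ∪ Sv).card = L₁.card + Su.card + Sv.card := by
      have := Finset.card_union_add_card_inter (L₁ ∪ Su) Sv
      have h0 : ((L₁ ∪ Su) ∩ Sv).card = 0 := by
        rw [Finset.card_eq_zero, Finset.eq_empty_iff_forall_notMem]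
        intro x hx
        rw [Finset.mem_inter, Finset.mem_union] at hx
        rcases hx.1 with h | h
        · exact (hS v hv).2.2 x hx.2 (Finset.mem_inter.1 h).2
        · exact hdisj u hu v hv huv x h hx.2
      omega
    have h3 : (L₁ ∪ Su ∪ Sv ∪ Sw).card = L₁.card + Su.card + Sv.card + Sw.card := by
      have := Finset.card_union_add_card_inter (L₁ ∪ Su ∪ Sv) Sw
      have h0 : ((L₁ ∪ Su ∪ Sv) ∩ Sw).card = 0 := by
        rw [Finset.card_eq_zero, Finset.eq_empty_iff_forall_notMem]
        intro x hx
        rw [Finset.mem_inter, Finset.mem_union, Finset.mem_union] at hx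
        rcases hx.1 with (h | h) | h
        · exact (hS w hw).2.2 x hx.2 (Finset.mem_inter.1 h).2
        · exact hdisj u hu w hw huw x h hx.2
        · exact hdisj v hv w hw hvw x h hx.2
      omega
    have hsubV : L₁ ∪ Su ∪ Sv ∪ Sw ⊆ V :=
      Finset.union_subset (Finset.union_subset (Finset.union_subset Finset.inter_subset_left (hS u hu).2.1)
        (hS v hv).2.1) (hS w hw).2.1
    have hV' := Finset.card_le_card hsubV
    have hv3 : 3 ≤ Sv.card := (hS v hv).1
    have hw3 : 3 ≤ Sw.card := (hS w hw).1
    omega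
  -- the points of `V` on a plane through `L₁`: at most the line and the missed set
  have hplane : ∀ u ∈ coloops M (insert z₁ B₁ \ coloops M G),
      V ∩ clF M (insert u R₁) ⊆ L₁ ∪ (G \ clF M ((insert z₁ B₁).erase u)) :=
    fun u hu => inter_clF_insert_subset hG hd hk hs hl hB₁ hbig₁ hz₁ hloss₁ hRQ₁ hR2₁ hRcard₁ hu
  -- two distinct lines share at most one point of `V`
  by_contra hne
  have hshare : (L₂ ∩ L₁).card ≤ 1 := by
    by_contra hlt
    push Not at hlt
    obtain ⟨w, hw, w', hw', hww'⟩ := Finset.one_lt_card.1 hlt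
    rw [hL₂, hL₁, Finset.mem_inter, Finset.mem_inter, Finset.mem_inter] at hw hw'
    apply hne
    have hpair : ({w, w'} : Finset α) ⊆ gr M := by
      intro x hx
      rw [Finset.mem_insert, Finset.mem_singleton] at hx
      rcases hx with rfl | rfl
      · exact hVg hw.1.1
      · exact hVg hw'.1.1
    have hsub₁ : ({w, w'} : Finset α) ⊆ clF M R₁ := by
      intro x hx
      rw [Finset.mem_insert, Finset.mem_singleton] at hx
      rcases hx with rfl | rfl
      · exact hw.2.2
      · exact hw'.2.2
    have hsub₂ : ({w, w'} : Finset α) ⊆ clF M R₂ := by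
      intro x hx
      rw [Finset.mem_insert, Finset.mem_singleton] at hx
      rcases hx with rfl | rfl
      · exact hw.1.2
      · exact hw'.1.2
    have e₁ : clF M {w, w'} = clF M R₁ :=
      clF_eq_clF_of_subset_clF_of_rkN_le hR₁g hsub₁ (by rw [hR2₁, hs w (hVg hw.1.1) w' (hVg hw'.1.1) hww'])
    have e₂ : clF M {w, w'} = clF M R₂ :=
      clF_eq_clF_of_subset_clF_of_rkN_le hR₂g hsub₂ (by rw [hR2₂, hs w (hVg hw.1.1) w' (hVg hw'.1.1) hww'])
    rw [← e₁, ← e₂]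
  -- two points of `L₂` in a common plane through `L₁` put `L₂` inside that plane
  have hone : ∀ u ∈ coloops M (insert z₁ B₁ \ coloops M G), ((L₂ \ L₁) ∩ clF M (insert u R₁)).card ≤ 1 := by
    intro u hu
    rw [Finset.card_le_one]
    intro x hx y hy
    by_contra hxy
    rw [Finset.mem_inter, Finset.mem_sdiff, hL₂, Finset.mem_inter] at hx hy
    have hxV : x ∈ V := hx.1.1.1
    have hyV : y ∈ V := hy.1.1.1
    have hpair : ({x, y} : Finset α) ⊆ gr M := by
      intro v hv
      rw [Finset.mem_insert, Finset.mem_singleton] at hv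
      rcases hv with rfl | rfl
      · exact hVg hxV
      · exact hVg hyV
    have hsub₂ : ({x, y} : Finset α) ⊆ clF M R₂ := by
      intro v hv
      rw [Finset.mem_insert, Finset.mem_singleton] at hv
      rcases hv with rfl | rfl
      · exact hx.1.1.2
      · exact hy.1.1.2
    have e₂ : clF M {x, y} = clF M R₂ :=
      clF_eq_clF_of_subset_clF_of_rkN_le hR₂g hsub₂ (by rw [hR2₂, hs x (hVg hxV) y (hVg hyV) hxy])
    have hsubP : ({x, y} : Finset α) ⊆ clF M (insert u R₁) := by
      intro v hv
      rw [Finset.mem_insert, Finset.mem_singleton] at hv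
      rcases hv with rfl | rfl
      · exact hx.2
      · exact hy.2
    have hL₂P : L₂ ⊆ L₁ ∪ (G \ clF M ((insert z₁ B₁).erase u)) := by
      intro v hv
      rw [hL₂, Finset.mem_inter] at hv
      apply hplane u hu
      rw [Finset.mem_inter]
      refine ⟨hv.1, ?_⟩
      have : v ∈ clF M {x, y} := by rw [e₂]; exact hv.2
      have h' := clF_mono hsubP this
      rw [clF_clF] at h'
      exact h'
    have hcard := Finset.card_le_card hL₂P
    have hU := Finset.card_union_le L₁ (G \ clF M ((insert z₁ B₁).erase u))
    -- `|L₂| ≤ |L₂ ∩ L₁| + |S_u| ≤ 1 + 3`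
    have hsplit : L₂ ⊆ (L₂ ∩ L₁) ∪ (G \ clF M ((insert z₁ B₁).erase u)) := by
      intro v hv
      rcases Finset.mem_union.1 (hL₂P hv) with h | h
      · exact Finset.mem_union_left _ (Finset.mem_inter.2 ⟨hv, h⟩)
      · exact Finset.mem_union_right _ h
    have h1 := Finset.card_le_card hsplit
    have h2 := Finset.card_union_le (L₂ ∩ L₁) (G \ clF M ((insert z₁ B₁).erase u))
    have h3 := hS3 u hu
    omega
  -- the points of `L₂` off `L₁` lie in the three planes, at most one each
  have hcover : L₂ \ L₁ ⊆ ((L₂ \ L₁) ∩ clF M (insert c R₁)) ∪ ((L₂ \ L₁) ∩ clF M (insert d R₁)) ∪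
      ((L₂ \ L₁) ∩ clF M (insert e R₁)) := by
    intro x hx
    have hxV : x ∈ V := by
      have h := (Finset.mem_sdiff.1 hx).1
      rw [hL₂, Finset.mem_inter] at h
      exact h.1
    have h := hcov hxV
    rw [Finset.mem_union, Finset.mem_union] at h
    rw [Finset.mem_union, Finset.mem_union, Finset.mem_inter, Finset.mem_inter, Finset.mem_inter]
    tauto
  have hc3 := Finset.card_le_card hcover
  have hc3' := Finset.card_union_le (((L₂ \ L₁) ∩ clF M (insert c R₁)) ∪ ((L₂ \ L₁) ∩ clF M (insert d R₁)))
    ((L₂ \ L₁) ∩ clF M (insert e R₁))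
  have hc3'' := Finset.card_union_le ((L₂ \ L₁) ∩ clF M (insert c R₁)) ((L₂ \ L₁) ∩ clF M (insert d R₁))
  have hc1 := hone c hc
  have hd1 := hone d hd'
  have he1 := hone e he
  have hsd := Finset.card_sdiff_add_card_inter L₂ L₁
  omega


/-- **No six-point three-planar line next to a line of `≥ 7` points** (`|V| = 15`). -/
theorem no_six_line_of_long_line (hG : G ∈ flatsQ M (5 + 1)) (hd : (gr M \ G).card = 2)
    (hk : kColoops M G = 1) (hs : ∀ e ∈ gr M, ∀ f ∈ gr M, e ≠ f → rkN M {e, f} = 2)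
    (hl : ∀ e ∈ gr M, M.Indep {e}) (hnf : fatClosures M 5 G 2 = ∅) (h15 : (G \ coloops M G).card = 15)
    {u v : α} (hu : u ∈ G \ coloops M G) (hv : v ∈ G \ coloops M G) (huv : u ≠ v)
    (h7 : 7 ≤ ((G \ coloops M G) ∩ clF M {u, v}).card) :
    ¬ ∃ B' ∈ thinMembers M 5 G, 5 ≤ (B' \ coloops M G).card ∧ ∃ z' ∈ G \ clF M B',
      loss M 5 G B' z' ≠ 0 ∧ gtPts M 5 G (insert z' B') = ∅ ∧ ∃ R ⊆ insert z' B' \ coloops M G, rkN M R = 2 ∧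
        R.card + 3 = (insert z' B' \ coloops M G).card ∧
        ((G \ coloops M G) ∩ clF M R).card + 9 = (G \ coloops M G).card := by
  rintro ⟨B', hB', hbig, z', hz', hloss, hempty, R, hRQ, hR2, hRcard, h9⟩
  have hGg : G ⊆ gr M := (mem_flatsQ.1 hG).1
  have h6 : ((G \ coloops M G) ∩ clF M R).card = 6 := by omega
  have hpair : ({u, v} : Finset α) ⊆ G \ coloops M G := by
    intro e he
    rw [Finset.mem_insert, Finset.mem_singleton] at he
    rcases he with rfl | rfl
    · exact hu
    · exact hv
  have hcl := clF_eq_of_six_line_of_five hG hd hk hs hl hnf h15 hB' hbig hz' hloss hRQ hR2 hRcard hempty h6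
    (R₂ := {u, v}) (hs u (hGg (Finset.mem_sdiff.1 hu).1) v (hGg (Finset.mem_sdiff.1 hv).1) huv) hpair (by omega)
  rw [hcl] at h6
  omega

/-- `ntpIncomeB` is antitone in the class sizes. -/
theorem ntpIncomeB_anti_e {N s d₁ d₂ e₁ e₂ e₁' e₂' f : ℕ} (h₁ : e₁ ≤ e₁') (h₂ : e₂ ≤ e₂') :
    ntpIncomeB N s d₁ d₂ e₁' e₂' f ≤ ntpIncomeB N s d₁ d₂ e₁ e₂ f := by
  unfold ntpIncomeB
  apply Finset.sum_le_sum
  intro i _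
  by_cases hsi : s ≤ i
  · rw [if_pos hsi, if_pos hsi]
    set w : ℚ := (if N ≤ i + 3 then (1 : ℚ) else 11 / 18) with hw
    set c : ℚ := (if N ≤ i + 3 then (0 : ℚ) else 3 * (((N - 2).choose i : ℕ) : ℚ) + 2 * ((f.choose i : ℕ) : ℚ)) with hc
    have hb : ((suspBound N i d₁ d₂ e₁ e₂ : ℕ) : ℚ) ≤ ((suspBound N i d₁ d₂ e₁' e₂' : ℕ) : ℚ) := by
      exact_mod_cast suspBound_mono_e h₁ h₂
    have hw0 : 0 ≤ w := by
      rw [hw]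
      split_ifs <;> norm_num
    have hC : (0 : ℚ) ≤ 3 / (((i + 5).choose 4 : ℕ) : ℚ) := by positivity
    have hmax : max 0 (((N.choose i : ℕ) : ℚ) - c - ((suspBound N i d₁ d₂ e₁' e₂' : ℕ) : ℚ)) ≤
        max 0 (((N.choose i : ℕ) : ℚ) - c - ((suspBound N i d₁ d₂ e₁ e₂ : ℕ) : ℚ)) := by
      apply max_le_max (le_refl 0)
      linarith
    calc w * max 0 (((N.choose i : ℕ) : ℚ) - c - ((suspBound N i d₁ d₂ e₁' e₂' : ℕ) : ℚ)) * 3 /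
          (((i + 5).choose 4 : ℕ) : ℚ)
        = (w * max 0 (((N.choose i : ℕ) : ℚ) - c - ((suspBound N i d₁ d₂ e₁' e₂' : ℕ) : ℚ))) *
            (3 / (((i + 5).choose 4 : ℕ) : ℚ)) := by ring
      _ ≤ (w * max 0 (((N.choose i : ℕ) : ℚ) - c - ((suspBound N i d₁ d₂ e₁ e₂ : ℕ) : ℚ))) *
            (3 / (((i + 5).choose 4 : ℕ) : ℚ)) := by
          apply mul_le_mul_of_nonneg_right _ hC
          exact mul_le_mul_of_nonneg_left hmax hw0
      _ = w * max 0 (((N.choose i : ℕ) : ℚ) - c - ((suspBound N i d₁ d₂ e₁ e₂ : ℕ) : ℚ)) * 3 /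
            (((i + 5).choose 4 : ℕ) : ℚ) := by ring
  · rw [if_neg hsi, if_neg hsi]

/-- `ntpIncomeB` is symmetric in the two basis-line sizes. -/
theorem ntpIncomeB_comm (N s d₁ d₂ e₁ e₂ f : ℕ) : ntpIncomeB N s d₁ d₂ e₁ e₂ f = ntpIncomeB N s d₂ d₁ e₁ e₂ f := by
  unfold ntpIncomeB
  apply Finset.sum_congr rfl
  intro i _
  have h : suspBound N i d₁ d₂ e₁ e₂ = suspBound N i d₂ d₁ e₁ e₂ := by
    unfold suspBound
    ring
  rw [h]

/-- The cell `(7, 0, 7, 0; f = 3)` at `N = 10`, `s = 6`: `27503/25740`. -/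
theorem one_le_ntpIncomeB_ten_seven : 1 ≤ ntpIncomeB 10 6 7 0 7 0 3 := by
  unfold ntpIncomeB suspBound
  simp only [Finset.sum_range_succ, Finset.sum_range_zero]
  norm_num [Nat.choose, max_def]

end PercRepro.Shadow
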